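import Literature.Analysis.Calculus.BorelCutoffSeries
import Mathlib.Analysis.Calculus.IteratedDeriv.Lemmas
import Mathlib.Analysis.Calculus.BumpFunction.FiniteDimension
import HarnessLib

/-!
# Borel's lemma by cut-off power series — Banach-valued coefficients, variable first

Topic `Analysis/Calculus`. This file is the vector-valued twin of
`Literature/Analysis/Calculus/BorelCutoffSeries.lean`: for smooth coefficients `bₖ : P → E` with
values in a real Banach space `E` (parameters `y` in a real normed space `P`) the cut-off series

  `W(s, y) = ∑ₖ (sᵏ / k!) χ(s / εₖ) • bₖ(y) = ∑ₖ cutoffMonomial k εₖ (s) • bₖ(y)`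

(`χ = 1` near `0`, `χ = 0` off `[-2, 2]`, the cut-off monomials `cutoffMonomial` of the scalar
file) is `C^∞` on `ℝ × P` as soon as the scales `εₖ ↓ 0` fast enough relative to finitely many
derivative bounds of the `bₖ`, and then `∂ₛʲ W(0, y) = bⱼ(y)` for all `j`, `y` (É. Borel's theorem
with parameters; Hörmander, *The Analysis of Linear Partial Differential Operators I*, Thm. 1.2.6).
Conventions: the VARIABLE `s = q.1` comes first, the PARAMETER `y = q.2` last (`W : ℝ × P → E`).

Main statements (all proved, no definitions; the scalar file's `cutoffMonomial`, `cutoffConst` are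
reused by import):

* `contDiff_tsum_cutoffMonomial_smul` — smoothness of the series on `ℝ × P` under the scale
  condition `εₖ Cₖ ∑_{i ≤ k} Sₖᵢ ≤ 4⁻ᵏ` (`‖Dⁱ bₖ‖ ≤ Sₖᵢ`);
* `iteratedDeriv_tsum_cutoffMonomial_smul_zero` — `∂ₛʲ W(0, y) = bⱼ(y)`;
* `exists_borel_extension_smul` — Borel's lemma with parameters in cut-off series form with the
  scale freedom `εₖ ≤ δₖ` (twin of the scalar `exists_borel_extension`);
* `exists_contDiff_iteratedDeriv_zeroSection_eq` — clean existence form for compactly supported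
  coefficients, any real normed parameter space;
* `exists_contDiff_iteratedDeriv_zeroSection_eq_of_finiteDimensional` — Borel's lemma with
  parameters without any support hypothesis, `P` finite-dimensional (annular exhaustion of `P`,
  the series being locally finite in `y`);
* riders: the `iteratedFDeriv` form of the conclusion and differentiation of the section identity
  in the parameter.

## References

* L. Hörmander, *The Analysis of Linear Partial Differential Operators I*, 2nd ed., Springer
  1990, §1.2 Thm. 1.2.6 (p. 16) (Borel's theorem with parameters `x ∈ K ⊂ ℝⁿ`, proof by the
  cut-off series `∑ g(t/εⱼ) tʲ fⱼ(x)/j!` with the bounds (1.2.4)). [HormanderALPDO1]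
-/

noncomputable section

open Set Function Filter Metric Finset
open scoped Topology ContDiff Nat

namespace Literature.Analysis.Calculus

/-! ### One variable, constant vector coefficients -/

section OneVariable

variable {E : Type*} [NormedAddCommGroup E] [NormedSpace ℝ E]

/-- Iterated derivatives of `s ↦ cutoffMonomial k ε s • w` for a constant vector `w`:
`(cutoffMonomial k ε • w)^{(j)} = (cutoffMonomial k ε)^{(j)} • w`. [cite: HormanderALPDO1, §1.2 Thm. 1.2.6 proof, (1.2.4) (p. 16)] -/
theorem iteratedDeriv_cutoffMonomial_smul_const (k : ℕ) (ε : ℝ) (w : E) (j : ℕ) (s : ℝ) :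
    iteratedDeriv j (fun s ↦ cutoffMonomial k ε s • w) s = iteratedDeriv j (cutoffMonomial k ε) s • w :=
  iteratedDeriv_smul_const ((contDiff_cutoffMonomial k ε).contDiffAt.of_le (by exact_mod_cast le_top)) w

/-- The terms `s ↦ cutoffMonomial k ε s • w` are smooth. [cite: HormanderALPDO1, §1.2 Thm. 1.2.6 proof, (1.2.4) (p. 16)] -/
theorem contDiff_cutoffMonomial_smul_const (k : ℕ) (ε : ℝ) (w : E) :
    ContDiff ℝ ∞ (fun s ↦ cutoffMonomial k ε s • w) :=
  (contDiff_cutoffMonomial k ε).smul contDiff_const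

/-- **Derivatives at `0`** of a term with a constant vector coefficient:
`(cutoffMonomial k ε • w)^{(j)}(0) = δⱼₖ w` (`ε > 0`). [cite: HormanderALPDO1, §1.2 Thm. 1.2.6 proof, (1.2.4) (p. 16)] -/
theorem iteratedDeriv_cutoffMonomial_smul_const_zero {k : ℕ} {ε : ℝ} (hε : 0 < ε) (w : E) (j : ℕ) :
    iteratedDeriv j (fun s ↦ cutoffMonomial k ε s • w) 0 = if j = k then w else 0 := by
  rw [iteratedDeriv_cutoffMonomial_smul_const, iteratedDeriv_cutoffMonomial_zero hε]
  split_ifs <;> simp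

/-- **The scaling bound for a term with a constant vector coefficient**: for `j < k` and
`0 < ε ≤ 1`, `‖(cutoffMonomial k ε • w)^{(j)}(s)‖ ≤ ε Cₖ ‖w‖`. [cite: HormanderALPDO1, §1.2 Thm. 1.2.6 proof, (1.2.4) (p. 16)] -/
theorem norm_iteratedFDeriv_cutoffMonomial_smul_const_le {k j : ℕ} (hj : j < k) {ε : ℝ}
    (hε : 0 < ε) (hε1 : ε ≤ 1) (w : E) (s : ℝ) :
    ‖iteratedFDeriv ℝ j (fun s ↦ cutoffMonomial k ε s • w) s‖ ≤ ε * cutoffConst k * ‖w‖ := by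
  rw [norm_iteratedFDeriv_eq_norm_iteratedDeriv, iteratedDeriv_cutoffMonomial_smul_const, norm_smul]
  exact mul_le_mul_of_nonneg_right (norm_iteratedDeriv_cutoffMonomial_le hj hε hε1 s) (norm_nonneg _)

/-- The terms have compact support, hence bounded derivatives of every order. [cite: HormanderALPDO1, §1.2 Thm. 1.2.6 proof, (1.2.4) (p. 16)] -/
theorem exists_norm_iteratedFDeriv_cutoffMonomial_smul_const_le {k : ℕ} {ε : ℝ} (hε : 0 < ε)
    (w : E) (j : ℕ) :
    ∃ M : ℝ, ∀ s, ‖iteratedFDeriv ℝ j (fun s ↦ cutoffMonomial k ε s • w) s‖ ≤ M := by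
  obtain ⟨C, _, hC⟩ := exists_norm_iteratedDeriv_cutoffProfile_le k j
  refine ⟨|ε ^ k * (ε⁻¹) ^ j| * C * ‖w‖, fun s ↦ ?_⟩
  rw [norm_iteratedFDeriv_eq_norm_iteratedDeriv, iteratedDeriv_cutoffMonomial_smul_const, norm_smul]
  refine mul_le_mul_of_nonneg_right ?_ (norm_nonneg _)
  have hfun : cutoffMonomial k ε = fun s ↦ ε ^ k * cutoffProfile k (ε⁻¹ * s) := by
    funext s; exact cutoffMonomial_eq_scale hε.ne' s
  have hj' : (j : WithTop ℕ∞) ≤ ∞ := by exact_mod_cast (le_top : (j : ℕ∞) ≤ ⊤)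
  rw [hfun, iteratedDeriv_const_mul _ (by
    exact ((contDiff_cutoffProfile k).comp (contDiff_const.mul contDiff_id)).contDiffAt.of_le hj')]
  have hcomp := iteratedDeriv_comp_const_mul ((contDiff_cutoffProfile k).of_le hj') ε⁻¹
  rw [show (fun s ↦ cutoffProfile k (ε⁻¹ * s)) = fun x ↦ cutoffProfile k (ε⁻¹ * x) from rfl, hcomp]
  show ‖ε ^ k * (ε⁻¹ ^ j * iteratedDeriv j (cutoffProfile k) (ε⁻¹ * s))‖ ≤ _
  rw [← mul_assoc, norm_mul, Real.norm_eq_abs]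
  exact mul_le_mul_of_nonneg_left (hC _) (abs_nonneg _)

variable [CompleteSpace E] {ε : ℕ → ℝ} {w : ℕ → E}

/-- **Master lemma (one variable, constant vector coefficients), derivatives at `0`.** If
`0 < εₖ ≤ 1` and `εₖ Cₖ ‖wₖ‖ ≤ 4⁻ᵏ`, then `(∑ₖ cutoffMonomial k εₖ • wₖ)^{(j)}(0) = wⱼ` for every `j`
(termwise differentiation, Mathlib's `iteratedFDeriv_tsum_apply`: the `j`-th derivatives of the
terms `k > j` are bounded by `2⁻ᵏ`, the finitely many others by compact support). [cite: HormanderALPDO1, §1.2 Thm. 1.2.6 (p. 16)] -/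
theorem iteratedDeriv_tsum_cutoffMonomial_smul_const_zero (hε : ∀ k, 0 < ε k) (hε1 : ∀ k, ε k ≤ 1)
    (hdec : ∀ k, ε k * cutoffConst k * ‖w k‖ ≤ (1 / 4) ^ k) (j : ℕ) :
    iteratedDeriv j (fun s ↦ ∑' k, cutoffMonomial k (ε k) s • w k) 0 = w j := by
  set f : ℕ → ℝ → E := fun k s ↦ cutoffMonomial k (ε k) s • w k with hf
  have hfs : ∀ k, ContDiff ℝ ∞ (f k) := fun k ↦ contDiff_cutoffMonomial_smul_const k (ε k) (w k)
  have hgeo : ∀ i k, i < k → ∀ s, ‖iteratedFDeriv ℝ i (f k) s‖ ≤ (1 / 2 : ℝ) ^ k := by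
    intro i k hik s
    refine (norm_iteratedFDeriv_cutoffMonomial_smul_const_le hik (hε k) (hε1 k) (w k) s).trans ?_
    refine (hdec k).trans ?_
    exact pow_le_pow_left₀ (by norm_num) (by norm_num) k
  choose M hM using fun k i ↦
    exists_norm_iteratedFDeriv_cutoffMonomial_smul_const_le (k := k) (hε k) (w k) i
  set v : ℕ → ℕ → ℝ := fun i k ↦ if i < k then (1 / 2 : ℝ) ^ k else M k i with hv
  have hvs : ∀ i : ℕ, ((i : ℕ∞) ≤ ⊤) → Summable (v i) := by
    intro i _
    have hgeom : Summable fun k : ℕ ↦ (1 / 2 : ℝ) ^ k :=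
      summable_geometric_of_lt_one (by norm_num) (by norm_num)
    have hdiff : Summable fun k : ℕ ↦ v i k - (1 / 2 : ℝ) ^ k := by
      refine summable_of_ne_finset_zero (s := range (i + 1)) fun k hk ↦ ?_
      have hik : i < k := by simpa [Finset.mem_range, Nat.lt_succ_iff, not_le] using hk
      simp [hv, hik]
    simpa using hdiff.add hgeom
  have hvb : ∀ (i : ℕ) (k : ℕ) (s : ℝ), ((i : ℕ∞) ≤ ⊤) → ‖iteratedFDeriv ℝ i (f k) s‖ ≤ v i k := by
    intro i k s _
    by_cases hik : i < k
    · simp only [hv, if_pos hik]; exact hgeo i k hik s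
    · simp only [hv, if_neg hik]; exact hM k i s
  have key := iteratedFDeriv_tsum_apply (𝕜 := ℝ) (N := (⊤ : ℕ∞)) hfs hvs hvb (k := j)
    (by exact_mod_cast le_top) (0 : ℝ)
  have hsumj : Summable fun k ↦ iteratedFDeriv ℝ j (f k) 0 :=
    .of_norm_bounded (hvs j le_top) fun k ↦ hvb j k 0 le_top
  rw [iteratedDeriv_eq_iteratedFDeriv, show (fun s ↦ ∑' k, cutoffMonomial k (ε k) s • w k) =
    fun s ↦ ∑' k, f k s from rfl, key, ContinuousMultilinearMap.tsum_eval hsumj]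
  simp_rw [← iteratedDeriv_eq_iteratedFDeriv, hf, iteratedDeriv_cutoffMonomial_smul_const_zero (hε _)]
  rw [tsum_eq_single j (fun k hk ↦ by rw [if_neg (Ne.symm hk)])]
  rw [if_pos rfl]

/-- **Master lemma (one variable, constant vector coefficients), smoothness**: under the same
hypotheses the series `s ↦ ∑ₖ cutoffMonomial k εₖ (s) • wₖ` is `C^∞` (Mathlib's
`contDiff_tsum_of_eventually`). [cite: HormanderALPDO1, §1.2 Thm. 1.2.6 (p. 16)] -/
theorem contDiff_tsum_cutoffMonomial_smul_const (hε : ∀ k, 0 < ε k) (hε1 : ∀ k, ε k ≤ 1)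
    (hdec : ∀ k, ε k * cutoffConst k * ‖w k‖ ≤ (1 / 4) ^ k) :
    ContDiff ℝ ∞ (fun s ↦ ∑' k, cutoffMonomial k (ε k) s • w k) := by
  refine contDiff_tsum_of_eventually (N := (⊤ : ℕ∞)) (v := fun _ k ↦ (1 / 2 : ℝ) ^ k)
    (fun k ↦ contDiff_cutoffMonomial_smul_const k (ε k) (w k))
    (fun j _ ↦ summable_geometric_of_lt_one (by norm_num) (by norm_num)) fun j _ ↦ ?_
  rw [eventually_cofinite]
  refine (finite_le_nat j).subset fun k hk ↦ ?_
  by_contra hjk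
  simp only [Set.mem_setOf_eq, not_le] at hjk
  refine hk fun s ↦ ?_
  refine (norm_iteratedFDeriv_cutoffMonomial_smul_const_le hjk (hε k) (hε1 k) (w k) s).trans ?_
  exact (hdec k).trans (pow_le_pow_left₀ (by norm_num) (by norm_num) k)

end OneVariable

/-! ### Parameters: smoothness on `ℝ × P` (variable first) -/

section Param

variable {P : Type*} [NormedAddCommGroup P] [NormedSpace ℝ P]
  {E : Type*} [NormedAddCommGroup E] [NormedSpace ℝ E]
  {ε : ℕ → ℝ} {b : ℕ → P → E} {S : ℕ → ℕ → ℝ}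

/-- Derivatives of `q ↦ c q.1` on `ℝ × P` are bounded by those of `c : ℝ → ℝ`. [cite: HormanderALPDO1, §1.2 Thm. 1.2.6 proof, (1.2.4) (p. 16)] -/
theorem norm_iteratedFDeriv_comp_fst_le_iteratedDeriv {c : ℝ → ℝ} (hc : ContDiff ℝ ∞ c) (i : ℕ)
    (q : ℝ × P) :
    ‖iteratedFDeriv ℝ i (fun q : ℝ × P ↦ c q.1) q‖ ≤ ‖iteratedDeriv i c q.1‖ := by
  have h := ContinuousLinearMap.iteratedFDeriv_comp_right (ContinuousLinearMap.fst ℝ ℝ P)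
    hc q (i := i) (by exact_mod_cast le_top)
  rw [show (fun q : ℝ × P ↦ c q.1) = c ∘ (ContinuousLinearMap.fst ℝ ℝ P) from rfl, h]
  refine (ContinuousMultilinearMap.norm_compContinuousLinearMap_le _ _).trans ?_
  rw [norm_iteratedFDeriv_eq_norm_iteratedDeriv]
  refine mul_le_of_le_one_right (norm_nonneg _) (prod_le_one (fun _ _ ↦ norm_nonneg _) ?_)
  intro _ _
  exact ContinuousLinearMap.norm_fst_le ℝ ℝ P

/-- Derivatives of `q ↦ b q.2` on `ℝ × P` are bounded by those of `b : P → E`. [cite: HormanderALPDO1, §1.2 Thm. 1.2.6 proof, (1.2.4) (p. 16)] -/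
theorem norm_iteratedFDeriv_comp_snd_le_of_contDiff {c : P → E} (hc : ContDiff ℝ ∞ c) (i : ℕ)
    (q : ℝ × P) :
    ‖iteratedFDeriv ℝ i (fun q : ℝ × P ↦ c q.2) q‖ ≤ ‖iteratedFDeriv ℝ i c q.2‖ := by
  have h := ContinuousLinearMap.iteratedFDeriv_comp_right (ContinuousLinearMap.snd ℝ ℝ P)
    hc q (i := i) (by exact_mod_cast le_top)
  rw [show (fun q : ℝ × P ↦ c q.2) = c ∘ (ContinuousLinearMap.snd ℝ ℝ P) from rfl, h]
  refine (ContinuousMultilinearMap.norm_compContinuousLinearMap_le _ _).trans ?_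
  refine mul_le_of_le_one_right (norm_nonneg _) (prod_le_one (fun _ _ ↦ norm_nonneg _) ?_)
  intro _ _
  exact ContinuousLinearMap.norm_snd_le ℝ ℝ P

/-- The terms `q ↦ cutoffMonomial k ε q.1 • bₖ q.2` are smooth on `ℝ × P`. [cite: HormanderALPDO1, §1.2 Thm. 1.2.6 proof, (1.2.4) (p. 16)] -/
theorem contDiff_cutoffMonomial_smul_param (k : ℕ) (ε' : ℝ) {c : P → E} (hc : ContDiff ℝ ∞ c) :
    ContDiff ℝ ∞ (fun q : ℝ × P ↦ cutoffMonomial k ε' q.1 • c q.2) :=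
  ((contDiff_cutoffMonomial k ε').comp contDiff_fst).smul (hc.comp contDiff_snd)

/-- **Bound for the derivatives of a term with parameters**: for `j < k`, `0 < εₖ ≤ 1`,
`‖Dⁱ bₖ‖ ≤ Sₖᵢ` (`≥ 0`), the `j`-th derivative of `(s, y) ↦ cutoffMonomial k εₖ (s) • bₖ(y)` is
bounded by `2ʲ εₖ Cₖ ∑_{i ≤ j} Sₖᵢ` everywhere (Leibniz bound for `•`, Mathlib's
`norm_iteratedFDeriv_smul_le`). [cite: HormanderALPDO1, §1.2 Thm. 1.2.6 proof, (1.2.4) (p. 16)] -/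
theorem norm_iteratedFDeriv_cutoffMonomial_smul_param_le {k j : ℕ} (hj : j < k) (hε : 0 < ε k)
    (hε1 : ε k ≤ 1) (hb : ContDiff ℝ ∞ (b k)) (hS0 : ∀ i, 0 ≤ S k i)
    (hS : ∀ i y, ‖iteratedFDeriv ℝ i (b k) y‖ ≤ S k i) (q : ℝ × P) :
    ‖iteratedFDeriv ℝ j (fun q : ℝ × P ↦ cutoffMonomial k (ε k) q.1 • b k q.2) q‖ ≤
      2 ^ j * (ε k * cutoffConst k) * ∑ i ∈ range (j + 1), S k i := by
  have hf : ContDiff ℝ ∞ (fun q : ℝ × P ↦ cutoffMonomial k (ε k) q.1) :=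
    (contDiff_cutoffMonomial k (ε k)).comp contDiff_fst
  have hg : ContDiff ℝ ∞ (fun q : ℝ × P ↦ b k q.2) := hb.comp contDiff_snd
  refine (norm_iteratedFDeriv_smul_le hf hg q (n := j) (by exact_mod_cast le_top)).trans ?_
  calc ∑ i ∈ range (j + 1), (j.choose i : ℝ) *
        ‖iteratedFDeriv ℝ i (fun q : ℝ × P ↦ cutoffMonomial k (ε k) q.1) q‖ *
        ‖iteratedFDeriv ℝ (j - i) (fun q : ℝ × P ↦ b k q.2) q‖
      ≤ ∑ i ∈ range (j + 1), (j.choose i : ℝ) * (ε k * cutoffConst k) *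
        ∑ i' ∈ range (j + 1), S k i' := by
        refine sum_le_sum fun i hi ↦ ?_
        have hij : i ≤ j := Nat.lt_succ_iff.1 (Finset.mem_range.1 hi)
        refine mul_le_mul (mul_le_mul_of_nonneg_left
          ((norm_iteratedFDeriv_comp_fst_le_iteratedDeriv (contDiff_cutoffMonomial k (ε k)) i q).trans
            (norm_iteratedDeriv_cutoffMonomial_le (hij.trans_lt hj) hε hε1 _))
          (Nat.cast_nonneg _)) ?_ (norm_nonneg _)
          (mul_nonneg (Nat.cast_nonneg _) (mul_nonneg hε.le (cutoffConst_nonneg k)))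
        exact ((norm_iteratedFDeriv_comp_snd_le_of_contDiff hb (j - i) q).trans (hS (j - i) q.2)).trans
          (single_le_sum (f := S k) (fun i _ ↦ hS0 i)
            (Finset.mem_range.2 (Nat.lt_succ_of_le (Nat.sub_le j i))))
    _ = 2 ^ j * (ε k * cutoffConst k) * ∑ i ∈ range (j + 1), S k i := by
        rw [← sum_mul, ← sum_mul]
        have := (Nat.cast_inj (R := ℝ)).2 (Nat.sum_range_choose j)
        push_cast at this
        rw [this]

variable [CompleteSpace E]

/-- **Smoothness of the cut-off series with parameters (variable first).** Let `0 < εₖ ≤ 1`,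
`bₖ : P → E` smooth with `‖Dⁱ bₖ‖ ≤ Sₖᵢ` everywhere (`Sₖᵢ ≥ 0`) and `εₖ Cₖ ∑_{i ≤ k} Sₖᵢ ≤ 4⁻ᵏ`.
Then `(s, y) ↦ ∑ₖ cutoffMonomial k εₖ (s) • bₖ(y)` is `C^∞` on `ℝ × P` (Mathlib's
`contDiff_tsum_of_eventually` with the bound `2⁻ᵏ` for the `j`-th derivatives of the terms
`k > j`). [cite: HormanderALPDO1, §1.2 Thm. 1.2.6 (p. 16)] -/
theorem contDiff_tsum_cutoffMonomial_smul (hε : ∀ k, 0 < ε k) (hε1 : ∀ k, ε k ≤ 1)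
    (hb : ∀ k, ContDiff ℝ ∞ (b k)) (hS0 : ∀ k i, 0 ≤ S k i)
    (hS : ∀ k i y, ‖iteratedFDeriv ℝ i (b k) y‖ ≤ S k i)
    (hdec : ∀ k, ε k * cutoffConst k * ∑ i ∈ range (k + 1), S k i ≤ (1 / 4) ^ k) :
    ContDiff ℝ ∞ (fun q : ℝ × P ↦ ∑' k, cutoffMonomial k (ε k) q.1 • b k q.2) := by
  refine contDiff_tsum_of_eventually (N := (⊤ : ℕ∞)) (v := fun _ k ↦ (1 / 2 : ℝ) ^ k)
    (fun k ↦ contDiff_cutoffMonomial_smul_param k (ε k) (hb k))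
    (fun j _ ↦ summable_geometric_of_lt_one (by norm_num) (by norm_num)) fun j _ ↦ ?_
  rw [eventually_cofinite]
  refine (finite_le_nat j).subset fun k hk ↦ ?_
  by_contra hjk
  simp only [Set.mem_setOf_eq, not_le] at hjk
  refine hk fun q ↦ ?_
  refine (norm_iteratedFDeriv_cutoffMonomial_smul_param_le hjk (hε k) (hε1 k) (hb k) (hS0 k)
    (hS k) q).trans ?_
  have hsum : ∑ i ∈ range (j + 1), S k i ≤ ∑ i ∈ range (k + 1), S k i :=
    sum_le_sum_of_subset_of_nonneg (range_subset_range.2 (by omega)) fun i _ _ ↦ hS0 k i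
  have hC : 0 ≤ ε k * cutoffConst k := mul_nonneg (hε k).le (cutoffConst_nonneg k)
  calc 2 ^ j * (ε k * cutoffConst k) * ∑ i ∈ range (j + 1), S k i
      ≤ 2 ^ j * (ε k * cutoffConst k * ∑ i ∈ range (k + 1), S k i) := by
        rw [mul_assoc]; gcongr
    _ ≤ 2 ^ j * (1 / 4) ^ k := by gcongr; exact hdec k
    _ ≤ 2 ^ k * (1 / 4) ^ k :=
        mul_le_mul_of_nonneg_right (pow_le_pow_right₀ (by norm_num) hjk.le) (by positivity)
    _ = (1 / 2) ^ k := by rw [← mul_pow]; norm_num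

/-- **The `s`-derivatives on the zero section**: under the hypotheses of
`contDiff_tsum_cutoffMonomial_smul` (with `εₖ ≤ 1`), for every parameter `y` and every `j`,
`∂ₛʲ (∑ₖ cutoffMonomial k εₖ (s) • bₖ(y))|_{s = 0} = bⱼ(y)`. [cite: HormanderALPDO1, §1.2 Thm. 1.2.6 (p. 16)] -/
theorem iteratedDeriv_tsum_cutoffMonomial_smul_zero (hε : ∀ k, 0 < ε k) (hε1 : ∀ k, ε k ≤ 1)
    (hS0 : ∀ k i, 0 ≤ S k i) (hS : ∀ k i y, ‖iteratedFDeriv ℝ i (b k) y‖ ≤ S k i)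
    (hdec : ∀ k, ε k * cutoffConst k * ∑ i ∈ range (k + 1), S k i ≤ (1 / 4) ^ k)
    (y : P) (j : ℕ) :
    iteratedDeriv j (fun s ↦ ∑' k, cutoffMonomial k (ε k) s • b k y) 0 = b j y := by
  refine iteratedDeriv_tsum_cutoffMonomial_smul_const_zero (w := fun k ↦ b k y) hε hε1
    (fun k ↦ ?_) j
  have h0 : ‖b k y‖ ≤ ∑ i ∈ range (k + 1), S k i := by
    have h1 : ‖b k y‖ ≤ S k 0 := by
      have := hS k 0 y
      rwa [norm_iteratedFDeriv_zero] at this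
    exact h1.trans (single_le_sum (f := S k) (fun i _ ↦ hS0 k i)
      (Finset.mem_range.2 (Nat.succ_pos k)))
  exact (mul_le_mul_of_nonneg_left h0 (mul_nonneg (hε k).le (cutoffConst_nonneg k))).trans
    (hdec k)

end Param

/-! ### Borel's lemma with parameters, Banach-valued -/

section Borel

variable {P : Type*} [NormedAddCommGroup P] [NormedSpace ℝ P]
  {E : Type*} [NormedAddCommGroup E] [NormedSpace ℝ E] [CompleteSpace E]

/-- **Borel's lemma with parameters, Banach-valued, cut-off series form.** Let `P` be a real
normed space, `E` a real Banach space, `bₖ : P → E` (`k ∈ ℕ`) smooth with compact support, and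
`δₖ > 0` prescribed bounds. Then there are scales `0 < εₖ ≤ min(δₖ, 1/2)` such that
`W(s, y) = ∑ₖ cutoffMonomial k εₖ (s) • bₖ(y)` is `C^∞` on `ℝ × P` and `∂ₛʲ W(0, y) = bⱼ(y)` for all
`j`, `y` (É. Borel; Hörmander, Thm. 1.2.6, with the parameter `y`; vector-valued twin of
`exists_borel_extension`). [cite: HormanderALPDO1, §1.2 Thm. 1.2.6 (p. 16)] -/
theorem exists_borel_extension_smul (b : ℕ → P → E) (hb : ∀ k, ContDiff ℝ ∞ (b k))
    (hbc : ∀ k, HasCompactSupport (b k)) (δ : ℕ → ℝ) (hδ : ∀ k, 0 < δ k) :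
    ∃ ε : ℕ → ℝ, (∀ k, 0 < ε k ∧ ε k ≤ δ k ∧ ε k ≤ 1 / 2) ∧
      ContDiff ℝ ∞ (fun q : ℝ × P ↦ ∑' k, cutoffMonomial k (ε k) q.1 • b k q.2) ∧
      ∀ (y : P) (j : ℕ), iteratedDeriv j (fun s ↦ ∑' k, cutoffMonomial k (ε k) s • b k y) 0 = b j y := by
  -- global bounds for the derivatives of the coefficients
  have hSex : ∀ k i, ∃ C : ℝ, 0 ≤ C ∧ ∀ y, ‖iteratedFDeriv ℝ i (b k) y‖ ≤ C := by
    intro k i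
    obtain ⟨C, hC⟩ := ((hb k).continuous_iteratedFDeriv
      (by exact_mod_cast le_top)).bounded_above_of_compact_support ((hbc k).iteratedFDeriv i)
    exact ⟨max C 0, le_max_right _ _, fun y ↦ (hC y).trans (le_max_left _ _)⟩
  choose S hS0 hS using hSex
  set T : ℕ → ℝ := fun k ↦ ∑ i ∈ range (k + 1), S k i with hT
  have hT0 : ∀ k, 0 ≤ T k := fun k ↦ sum_nonneg fun i _ ↦ hS0 k i
  -- the scales
  set ε : ℕ → ℝ := fun k ↦ min (δ k) (min (1 / 2) ((1 / 4) ^ k / (cutoffConst k * T k + 1)))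
    with hεdef
  have hpos : ∀ k, 0 < cutoffConst k * T k + 1 := fun k ↦
    add_pos_of_nonneg_of_pos (mul_nonneg (cutoffConst_nonneg k) (hT0 k)) one_pos
  have hε : ∀ k, 0 < ε k := fun k ↦ lt_min (hδ k) (lt_min (by norm_num) (div_pos (by positivity) (hpos k)))
  have hεδ : ∀ k, ε k ≤ δ k := fun k ↦ min_le_left _ _
  have hε2 : ∀ k, ε k ≤ 1 / 2 := fun k ↦ (min_le_right _ _).trans (min_le_left _ _)
  have hε1 : ∀ k, ε k ≤ 1 := fun k ↦ (hε2 k).trans (by norm_num)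
  have hdec : ∀ k, ε k * cutoffConst k * ∑ i ∈ range (k + 1), S k i ≤ (1 / 4) ^ k := by
    intro k
    have h1 : ε k ≤ (1 / 4) ^ k / (cutoffConst k * T k + 1) :=
      (min_le_right _ _).trans (min_le_right _ _)
    have hCT : 0 ≤ cutoffConst k * T k := mul_nonneg (cutoffConst_nonneg k) (hT0 k)
    calc ε k * cutoffConst k * ∑ i ∈ range (k + 1), S k i = ε k * (cutoffConst k * T k) := by
          rw [hT]; ring
      _ ≤ (1 / 4) ^ k / (cutoffConst k * T k + 1) * (cutoffConst k * T k) := by gcongr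
      _ ≤ (1 / 4) ^ k := by
          rw [div_mul_eq_mul_div, div_le_iff₀ (hpos k)]
          nlinarith [pow_pos (by norm_num : (0 : ℝ) < 1 / 4) k]
  exact ⟨ε, fun k ↦ ⟨hε k, hεδ k, hε2 k⟩, contDiff_tsum_cutoffMonomial_smul hε hε1 hb hS0 hS hdec,
    fun y j ↦ iteratedDeriv_tsum_cutoffMonomial_smul_zero hε hε1 hS0 hS hdec y j⟩

/-- **Borel's lemma with parameters, Banach-valued, existence form** (compactly supported
coefficients, any real normed parameter space): for smooth compactly supported `bₖ : P → E` there
is a `C^∞` map `W : ℝ × P → E` with `∂ₛʲ W(0, y) = bⱼ(y)` for all `j`, `y`. [cite: HormanderALPDO1, §1.2 Thm. 1.2.6 (p. 16)] -/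
theorem exists_contDiff_iteratedDeriv_zeroSection_eq (b : ℕ → P → E) (hb : ∀ k, ContDiff ℝ ∞ (b k))
    (hbc : ∀ k, HasCompactSupport (b k)) :
    ∃ W : ℝ × P → E, ContDiff ℝ ∞ W ∧
      ∀ (y : P) (j : ℕ), iteratedDeriv j (fun s ↦ W (s, y)) 0 = b j y := by
  obtain ⟨ε, -, hW, hWj⟩ := exists_borel_extension_smul b hb hbc (fun _ ↦ 1) (fun _ ↦ one_pos)
  exact ⟨fun q ↦ ∑' k, cutoffMonomial k (ε k) q.1 • b k q.2, hW, hWj⟩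

end Borel

section Riders

variable {P : Type*} {E : Type*} [NormedAddCommGroup E] [NormedSpace ℝ E]

/-- The `iteratedFDeriv` form of a section identity: `∂ₛʲ W(0, y) = bⱼ(y)` stated with the `j`-th
Fréchet derivative of `s ↦ W(s, y)` at `0` evaluated at `(1, …, 1)`. [cite: HormanderALPDO1, §1.2 Thm. 1.2.6 (p. 16)] -/
theorem iteratedFDeriv_apply_one_eq_of_iteratedDeriv_eq {W : ℝ × P → E} {b : ℕ → P → E}
    (hWj : ∀ (y : P) (j : ℕ), iteratedDeriv j (fun s ↦ W (s, y)) 0 = b j y) (y : P) (j : ℕ) :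
    iteratedFDeriv ℝ j (fun s ↦ W (s, y)) 0 (fun _ ↦ 1) = b j y := by
  rw [← iteratedDeriv_eq_iteratedFDeriv]
  exact hWj y j

/-- **Differentiating the section identity in the parameter**: if `∂ₛʲ W(0, y) = bⱼ(y)` for all
`y`, then every iterated `y`-derivative of `y ↦ ∂ₛʲ W(0, y)` is that of `bⱼ`. [cite: HormanderALPDO1, §1.2 Thm. 1.2.6 (p. 16)] -/
theorem iteratedFDeriv_iteratedDeriv_zeroSection_eq [NormedAddCommGroup P] [NormedSpace ℝ P]
    {W : ℝ × P → E} {b : ℕ → P → E}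
    (hWj : ∀ (y : P) (j : ℕ), iteratedDeriv j (fun s ↦ W (s, y)) 0 = b j y) (i j : ℕ) (y₀ : P) :
    iteratedFDeriv ℝ i (fun y ↦ iteratedDeriv j (fun s ↦ W (s, y)) 0) y₀ = iteratedFDeriv ℝ i (b j) y₀ := by
  have h : (fun y ↦ iteratedDeriv j (fun s ↦ W (s, y)) 0) = b j := funext fun y ↦ hWj y j
  rw [h]

end Riders

/-! ### No support hypothesis: finite-dimensional parameter space -/

section FiniteDimensional

variable {P : Type*} [NormedAddCommGroup P] [NormedSpace ℝ P] [FiniteDimensional ℝ P]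
  {E : Type*} [NormedAddCommGroup E] [NormedSpace ℝ E] [CompleteSpace E]

/-- **Borel's lemma with parameters, Banach-valued, no support hypothesis** (`P`
finite-dimensional): for smooth `bₖ : P → E` there is a `C^∞` map `W : ℝ × P → E` with
`∂ₛʲ W(0, y) = bⱼ(y)` for all `j` and all `y ∈ P`. Proof: annular exhaustion of `P` by smooth
bumps `χₙ` (`= 1` on the ball of radius `n + 1`, supported in the ball of radius `n + 2`),
`bₖ = ∑ₙ (χₙ − χₙ₋₁) bₖ` with compactly supported pieces; the cut-off series of the pieces
(`exists_borel_extension_smul`) vanish where the pieces do, so their sum over `n` is locally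
finite in `y`, hence smooth, with the prescribed `s`-derivatives. [cite: HormanderALPDO1, §1.2 Thm. 1.2.6 (p. 16)] -/
theorem exists_contDiff_iteratedDeriv_zeroSection_eq_of_finiteDimensional
    (b : ℕ → P → E) (hb : ∀ k, ContDiff ℝ ∞ (b k)) :
    ∃ W : ℝ × P → E, ContDiff ℝ ∞ W ∧
      ∀ (y : P) (j : ℕ), iteratedDeriv j (fun s ↦ W (s, y)) 0 = b j y := by
  classical
  -- annular exhaustion: `χ n = 1` on `closedBall 0 (n + 1)`, `= 0` off `ball 0 (n + 2)`
  let χ : ℕ → ContDiffBump (0 : P) := fun n ↦ ⟨n + 1, n + 2, by positivity, by linarith⟩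
  -- `F 0 = 0`, `F (n + 1) = χ n`; the pieces are `ψ n = F (n + 1) - F n`
  let F : ℕ → P → ℝ := fun n ↦ Nat.rec (fun _ ↦ (0 : ℝ)) (fun m _ ↦ (χ m : P → ℝ)) n
  have hF0 : F 0 = fun _ ↦ 0 := rfl
  have hFsucc : ∀ m, F (m + 1) = (χ m : P → ℝ) := fun m ↦ rfl
  have hFsmooth : ∀ n, ContDiff ℝ ∞ (F n) := by
    intro n
    cases n with
    | zero => rw [hF0]; exact contDiff_const
    | succ m => rw [hFsucc]; exact (χ m).contDiff
  -- `F n y = 1` for `‖y‖ ≤ n`, `n ≥ 1`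
  have hFone : ∀ (n : ℕ) (y : P), 1 ≤ n → ‖y‖ ≤ (n : ℝ) → F n y = 1 := by
    intro n y hn hy
    obtain ⟨m, rfl⟩ : ∃ m, n = m + 1 := ⟨n - 1, by omega⟩
    rw [hFsucc]
    refine (χ m).one_of_mem_closedBall ?_
    rw [mem_closedBall, dist_zero_right]
    show ‖y‖ ≤ (m : ℝ) + 1
    exact_mod_cast hy
  -- `F n y = 0` for `n + 1 ≤ ‖y‖`
  have hFzero : ∀ (n : ℕ) (y : P), (n : ℝ) + 1 ≤ ‖y‖ → F n y = 0 := by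
    intro n y hy
    cases n with
    | zero => rw [hF0]
    | succ m =>
      rw [hFsucc]
      refine (χ m).zero_of_le_dist ?_
      rw [dist_zero_right]
      show (m : ℝ) + 2 ≤ ‖y‖
      push_cast at hy
      linarith
  set ψ : ℕ → P → ℝ := fun n y ↦ F (n + 1) y - F n y with hψ
  have hψsmooth : ∀ n, ContDiff ℝ ∞ (ψ n) := fun n ↦ (hFsmooth (n + 1)).sub (hFsmooth n)
  -- the pieces vanish on `‖y‖ ≤ n` (`n ≥ 1`) and off `‖y‖ < n + 2`
  have hψzero : ∀ (n : ℕ) (y : P), 1 ≤ n → ‖y‖ ≤ (n : ℝ) → ψ n y = 0 := by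
    intro n y hn hy
    simp only [hψ]
    rw [hFone (n + 1) y (by omega) (hy.trans (by push_cast; linarith)), hFone n y hn hy,
      sub_self]
  have hψzero' : ∀ (n : ℕ) (y : P), (n : ℝ) + 2 ≤ ‖y‖ → ψ n y = 0 := by
    intro n y hy
    simp only [hψ]
    rw [hFzero (n + 1) y (by push_cast; linarith), hFzero n y (by linarith), sub_self]
  -- telescoping: `∑_{n < N} ψ n = F N`
  have hψsum : ∀ N (y : P), ∑ n ∈ range N, ψ n y = F N y := by
    intro N y
    have := Finset.sum_range_sub (fun n ↦ F n y) N
    simp only [hF0, sub_zero] at this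
    simpa only [hψ] using this
  -- the compactly supported pieces of the coefficients
  set c : ℕ → ℕ → P → E := fun n k y ↦ ψ n y • b k y with hc
  have hcs : ∀ n k, ContDiff ℝ ∞ (c n k) := fun n k ↦ (hψsmooth n).smul (hb k)
  have hcc : ∀ n k, HasCompactSupport (c n k) := by
    intro n k
    refine HasCompactSupport.of_support_subset_isCompact (isCompact_closedBall (0 : P) (n + 2)) ?_
    intro y hy
    rw [mem_closedBall, dist_zero_right]
    by_contra h
    refine hy ?_
    show ψ n y • b k y = 0
    rw [hψzero' n y (not_le.1 h).le, zero_smul]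
  -- Borel's lemma for each piece
  have hpiece : ∀ n, ∃ ε : ℕ → ℝ, (∀ k, 0 < ε k) ∧
      ContDiff ℝ ∞ (fun q : ℝ × P ↦ ∑' k, cutoffMonomial k (ε k) q.1 • c n k q.2) ∧
      ∀ (y : P) (j : ℕ), iteratedDeriv j (fun s ↦ ∑' k, cutoffMonomial k (ε k) s • c n k y) 0
        = c n j y := by
    intro n
    obtain ⟨ε, hε, hW, hWj⟩ := exists_borel_extension_smul (c n) (hcs n) (hcc n) (fun _ ↦ 1)
      (fun _ ↦ one_pos)
    exact ⟨ε, fun k ↦ (hε k).1, hW, hWj⟩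
  choose ε hε hW hWj using hpiece
  set Wn : ℕ → ℝ × P → E := fun n q ↦ ∑' k, cutoffMonomial k (ε n k) q.1 • c n k q.2 with hWn
  -- the pieces of the series vanish where the pieces of the coefficients do
  have hWnzero : ∀ (n : ℕ) (q : ℝ × P), 1 ≤ n → ‖q.2‖ ≤ (n : ℝ) → Wn n q = 0 := by
    intro n q hn hq
    simp only [hWn, hc, hψzero n q.2 hn hq, zero_smul, smul_zero, tsum_zero]
  -- local finiteness: on `‖q.2‖ < N` only the pieces `n < N` survive
  have hWsum : ∀ (N : ℕ) (q : ℝ × P), ‖q.2‖ < (N : ℝ) → ∑' n, Wn n q = ∑ n ∈ range N, Wn n q := by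
    intro N q hq
    refine tsum_eq_sum fun n hn ↦ ?_
    have hNn : N ≤ n := by simpa [Finset.mem_range, not_lt] using hn
    have h1 : 1 ≤ n := by
      rcases Nat.eq_zero_or_pos N with hN | hN
      · subst hN
        exact absurd hq (by simp)
      · omega
    exact hWnzero n q h1 (hq.le.trans (by exact_mod_cast hNn))
  refine ⟨fun q ↦ ∑' n, Wn n q, ?_, ?_⟩
  · -- smoothness: locally a finite sum of smooth functions
    refine contDiff_iff_contDiffAt.2 fun q₀ ↦ ?_
    set N : ℕ := ⌊‖q₀.2‖⌋₊ + 1 with hN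
    have hq₀ : ‖q₀.2‖ < (N : ℝ) := by
      rw [hN]; push_cast; exact Nat.lt_floor_add_one ‖q₀.2‖
    have hopen : IsOpen {q : ℝ × P | ‖q.2‖ < (N : ℝ)} :=
      isOpen_lt (continuous_norm.comp continuous_snd) continuous_const
    have hev : (fun q ↦ ∑' n, Wn n q) =ᶠ[𝓝 q₀] fun q ↦ ∑ n ∈ range N, Wn n q := by
      filter_upwards [hopen.mem_nhds hq₀] with q hq
      exact hWsum N q hq
    refine (ContDiffAt.congr_of_eventuallyEq ?_ hev)
    exact (ContDiffAt.sum fun n _ ↦ (hW n).contDiffAt)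
  · -- the section identity
    intro y j
    set N : ℕ := ⌊‖y‖⌋₊ + 1 with hN
    have hy : ‖y‖ < (N : ℝ) := by
      rw [hN]; push_cast; exact Nat.lt_floor_add_one ‖y‖
    have hfun : (fun s ↦ ∑' n, Wn n (s, y)) = fun s ↦ ∑ n ∈ range N, Wn n (s, y) := by
      funext s
      exact hWsum N (s, y) hy
    have hWny : ∀ n, ContDiff ℝ ∞ (fun s ↦ Wn n (s, y)) := fun n ↦
      (hW n).comp (contDiff_prodMk_left y)
    rw [hfun, iteratedDeriv_eq_iteratedFDeriv, iteratedFDeriv_fun_sum_apply (fun n _ ↦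
      (hWny n).contDiffAt.of_le (by exact_mod_cast le_top)), _root_.sum_apply]
    have hterm : ∀ n ∈ range N, iteratedFDeriv ℝ j (fun s ↦ Wn n (s, y)) 0 (fun _ ↦ 1) = c n j y := by
      intro n _
      rw [← iteratedDeriv_eq_iteratedFDeriv]
      exact hWj n y j
    rw [sum_congr rfl hterm]
    simp only [hc]
    rw [← sum_smul, hψsum N y, hFone N y (by rw [hN]; omega) hy.le, one_smul]

end FiniteDimensional

end Literature.Analysis.Calculus

end
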